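import Summits.BirchSwinnertonDyer.BirchSwinnertonDyer.Theorems.ManinLocalTwoThreeShimuraIndexKatz
import HarnessLib

/-!
# The Shimura-index DICHOTOMY: `p ∣ [Λ₀(f) : Λ₁(f)]` ⟹ a rational point of order `p` ON `W`, or a rational `p`-line of `W`
# with TRIVIAL quotient character (the `μ_p`-configuration)

Summit `BirchSwinnertonDyer`, route `ManinLocalTwoThree` (cell bsd-f2-manin), cruxes C2 `ManinOddAtFour`
(stmt-BirchSwinnertonDyer-22967) / C3 `ManinPrimeToThreeAtNine` (stmt-BirchSwinnertonDyer-22968).  Prover seat bsd-line-manin23-p1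
(C2/C3 LEAD), gen 9; sequel to `ManinLocalTwoThreeShimuraIndexKatz.lean`.

For a globally minimal elliptic `W/ℚ`, its newform `f` (any level), a prime `p`:

* `exists_addOrderOf_eq_or_exists_trivialQuotientLine_of_forall_exists_smul_eq` — the case split INSIDE Katz's theorem
  (tree `exists_isogeny_addOrderOf_eq_of_forall_exists_smul_eq`, whose packaged conclusion «a `p`-point on a `p`-isogenous
  curve» forgets it): if every `σ ∈ Γ_ℚ` fixes a non-zero point of `W[p]`, then EITHER `W(ℚ)` has a point of order `p`, OR
  there is a `Γ_ℚ`-stable line `H ≤ W[p]` (`#H = p`) with `Γ_ℚ` acting TRIVIALLY on `W[p]/H` (`σT − T ∈ H` for all `σ, T`) —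
  i.e. `W[p] ≅ (χ *; 0 1)`; since `det = ω` (Weil pairing, not used here) this is `H ≅ μ_p`.
* **`exists_addOrderOf_eq_or_exists_trivialQuotientLine_of_not_shimuraIndexPrimeTo`** — hence the same dichotomy from
  `¬ ShimuraIndexPrimeTo p f` (Eisenstein congruence at every good prime, `dvd_frobeniusTrace_sub_of_not_shimuraIndexPrimeTo`,
  + the tree's Frobenius step `forall_exists_smul_eq_of_frobeniusTrace_congr`).
* `shimuraIndexPrimeTo_of_no_torsion_of_no_trivialQuotientLine`, `plusIndexPrimeTo_of_no_torsion_of_no_trivialQuotientLine` —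
  contrapositives; at `p = 3` (`…_three`) this is es's E-es-67 with its open part PINNED to the `μ₃`-configuration classes
  (E-es-67♯'s locus), at every level and without optimality; an's E-an-128 (`3`-point on the optimal `W`) ⟺ «no lattice-optimal
  `W` with `3 ∣ [Λ₀:Λ₁]` is in the `μ₃`-configuration without a rational `3`-point».

HONEST FRAMING: unconditional tree theorems; the identification «trivial quotient character ⟺ `H ≅ μ_p` ⟺ (p = 3)
`HasShortMuThree`» needs `det ρ̄ = ω` and coordinates and is NOT done here.  No crux stub is narrowed; C2, C3, Manin's conjecture
and BSD are NOT proved by this file.  No definitions, no sorry.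

References: N. M. Katz, Invent. Math. 62 (1981), Thm. 2 [Katz1980]; J. Cullinan, M. Kenney, J. Voight, J. Théor. Nombres
Bordeaux 34 (2022), Lemma 2.3.5 / Cor. 2.3.6 [CullinanKenneyVoight2022]; K. Ribet, Sém. Th. Nombres Bordeaux 1987–88, exp. 6
[Ribet1988Shimura].
-/

set_option autoImplicit false
set_option linter.dupNamespace false

noncomputable section

open scoped Classical MatrixGroups ModularForm

open CongruenceSubgroup Complex WeierstrassCurve Field Literature.NumberTheory.EllipticCurves
  Literature.NumberTheory.EllipticCurves.ModularForms
open Summit.BirchSwinnertonDyer.Rank1Residual.ManinAdditive.KatoCurve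
  Summit.BirchSwinnertonDyer.Rank1Residual.ManinAdditive.CuspidalKummer

namespace Summit.BirchSwinnertonDyer.BirchSwinnertonDyer.Theorems.ManinLocalTwoThree

variable (W : WeierstrassCurve ℚ) [W.IsElliptic]

/-! ### §1. The case split inside Katz's theorem -/

/-- **A rational `p`-point, or a stable line with trivial quotient character.**  If every `σ ∈ Γ_ℚ` fixes a non-zero point
of `W[p]` (`p` prime), then either `W(ℚ)` has a point of order `p`, or there is a `Γ_ℚ`-stable subgroup `H ≤ W[p]` of order
`p` such that `σ • T − T ∈ H` for every `σ ∈ Γ_ℚ` and `T ∈ W[p]`.  (The invariant line `H` of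
`exists_stable_addSubgroup_of_natCard_eq_sq`; element-wise dichotomy `σP₀ = P₀ ∨ (σ − 1)W[p] ⊆ H`; the two sets are subgroups
covering `Γ_ℚ`; Galois descent `exists_addOrderOf_eq_of_smul_eq` in the first case.  Verbatim the first half of the tree's
`exists_isogeny_addOrderOf_eq_of_forall_exists_smul_eq`.) [cite: CullinanKenneyVoight2022, Lemma 2.3.5] [cite: Katz1980, Thm. 2 (m = ℓ) and Lemma 1] -/
theorem exists_addOrderOf_eq_or_exists_trivialQuotientLine_of_forall_exists_smul_eq (p : ℕ) [Fact p.Prime]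
    (hfix : ∀ σ : absoluteGaloisGroup ℚ, ∃ P : W.geomTorsion p, P ≠ 0 ∧ σ • P = P) :
    (∃ Q : W.toAffine.Point, addOrderOf Q = p) ∨
      ∃ H : AddSubgroup (W.geomTorsion p), Nat.card H = p ∧
        (∀ σ : absoluteGaloisGroup ℚ, ∀ a ∈ H, σ • a ∈ H) ∧
        ∀ (σ : absoluteGaloisGroup ℚ) (T : W.geomTorsion p), σ • T - T ∈ H := by
  classical
  have hp : p.Prime := Fact.out
  -- `E[p]` is an `𝔽_p`-plane
  have hcard : Nat.card (W.geomTorsion p) = p ^ 2 := natCard_geomTorsion W p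
  haveI hfin : Finite (W.geomTorsion p) :=
    Nat.finite_of_card_ne_zero (by rw [hcard]; exact pow_ne_zero 2 hp.ne_zero)
  -- `ℤ`-multiples commute with the Galois action
  have hσz : ∀ (σ : absoluteGaloisGroup ℚ) (k : ℤ) (T : W.geomTorsion p),
      σ • (k • T) = k • σ • T := fun σ k T ↦ by
    rw [← DistribMulAction.toAddMonoidHom_apply, map_zsmul, DistribMulAction.toAddMonoidHom_apply]
  -- an invariant line `H`
  obtain ⟨H, hH, hbot, htop⟩ : ∃ H : AddSubgroup (W.geomTorsion p),
      (∀ σ : absoluteGaloisGroup ℚ, ∀ a ∈ H, σ • a ∈ H) ∧ H ≠ ⊥ ∧ H ≠ ⊤ := by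
    letI : Module (ZMod p) (W.geomTorsion p) := AddSubgroup.torsionBy.zmodModule
    exact Literature.RepresentationTheory.FiniteGroups.Representation.exists_stable_addSubgroup_of_natCard_eq_sq
      hcard hfix
  -- `#H = p`
  have hHcard : Nat.card H = p := by
    have hdvd : Nat.card H ∣ Nat.card (W.geomTorsion p) := AddSubgroup.card_addSubgroup_dvd_card H
    rw [hcard] at hdvd
    obtain ⟨k, hk, hk'⟩ := (Nat.dvd_prime_pow hp).mp hdvd
    interval_cases k
    · exact absurd (AddSubgroup.eq_bot_of_card_eq H (by simpa using hk')) hbot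
    · simpa using hk'
    · exact absurd ((AddSubgroup.card_eq_iff_eq_top H).mp (hk'.trans hcard.symm)) htop
  -- a generator `P₀` of `H`
  haveI : Finite H := Finite.of_injective _ Subtype.coe_injective
  haveI : Nontrivial H := Finite.one_lt_card_iff_nontrivial.mp (by rw [hHcard]; exact hp.one_lt)
  obtain ⟨⟨P₀, hP₀H⟩, hP₀'⟩ := exists_ne (0 : H)
  have hP₀0 : P₀ ≠ 0 := fun h ↦ hP₀' (Subtype.ext h)
  have hordP₀ : addOrderOf P₀ = p := addOrderOf_eq_of_ne_zero W p hP₀0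
  have hHeq : AddSubgroup.zmultiples P₀ = H := by
    refine AddSubgroup.eq_of_le_of_card_ge (AddSubgroup.zmultiples_le.mpr hP₀H) ?_
    rw [hHcard, Nat.card_zmultiples, hordP₀]
  -- the scalar by which `σ` acts on `P₀`
  have hσP₀ : ∀ σ : absoluteGaloisGroup ℚ, ∃ m : ℤ, σ • P₀ = m • P₀ := fun σ ↦ by
    have h := hH σ P₀ hP₀H
    rw [← hHeq, AddSubgroup.mem_zmultiples_iff] at h
    obtain ⟨m, hm⟩ := h
    exact ⟨m, hm.symm⟩
  -- `p ∣ k` iff `k • P₀ = 0`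
  have hzP₀ : ∀ k : ℤ, k • P₀ = 0 ↔ (p : ℤ) ∣ k := fun k ↦ by
    have h := addOrderOf_dvd_iff_zsmul_eq_zero (x := P₀) (i := k)
    rw [hordP₀] at h
    exact h.symm
  -- the dichotomy, element by element: `σ P₀ = P₀` or `(σ − 1) E[p] ⊆ H`
  have hdich : ∀ σ : absoluteGaloisGroup ℚ,
      σ • P₀ = P₀ ∨ ∀ T : W.geomTorsion p, σ • T - T ∈ H := by
    intro σ
    obtain ⟨R, hR0, hσR⟩ := hfix σ
    obtain ⟨m, hm⟩ := hσP₀ σ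
    by_cases hRH : R ∈ H
    · -- `R = k • P₀` is fixed, so `σ` acts trivially on the line
      left
      rw [← hHeq, AddSubgroup.mem_zmultiples_iff] at hRH
      obtain ⟨k, rfl⟩ := hRH
      have hk : ¬ (p : ℤ) ∣ k := fun h ↦ hR0 ((hzP₀ k).mpr h)
      have h1 : (k * (m - 1)) • P₀ = 0 := by
        have h2 : σ • (k • P₀) = (k * m) • P₀ := by rw [hσz, hm, smul_smul]
        rw [mul_sub, mul_one, sub_smul, ← h2, hσR, sub_self]
      have h3 : (p : ℤ) ∣ m - 1 :=
        ((Nat.prime_iff_prime_int.mp hp).dvd_or_dvd ((hzP₀ _).mp h1)).resolve_left hk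
      rw [hm]
      calc m • P₀ = (m - 1) • P₀ + P₀ := by rw [sub_smul, one_smul, sub_add_cancel]
        _ = P₀ := by rw [(hzP₀ _).mpr h3, zero_add]
    · -- `E[p] = H + ℤ R`, and `σ` fixes `R`
      right
      have htop' : H ⊔ AddSubgroup.zmultiples R = ⊤ := by
        set K := H ⊔ AddSubgroup.zmultiples R with hK
        have hHK : H ≤ K := le_sup_left
        have hRK : R ∈ K := (le_sup_right : AddSubgroup.zmultiples R ≤ K)
          (AddSubgroup.mem_zmultiples R)
        have hne : H ≠ K := fun h ↦ hRH (h ▸ hRK)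
        haveI : Finite K := Finite.of_injective _ Subtype.coe_injective
        have hKdvd : Nat.card K ∣ Nat.card (W.geomTorsion p) :=
          AddSubgroup.card_addSubgroup_dvd_card K
        rw [hcard] at hKdvd
        have hHdvdK : Nat.card H ∣ Nat.card K := AddSubgroup.card_dvd_of_le hHK
        rw [hHcard] at hHdvdK
        obtain ⟨k, hk, hk'⟩ := (Nat.dvd_prime_pow hp).mp hKdvd
        interval_cases k
        · rw [hk', pow_zero] at hHdvdK
          exact absurd (Nat.le_of_dvd one_pos hHdvdK) (not_le.mpr hp.one_lt)
        · exact absurd (AddSubgroup.eq_of_le_of_card_ge hHK (by rw [hk', pow_one, hHcard])) hne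
        · exact (AddSubgroup.card_eq_iff_eq_top K).mp (hk'.trans hcard.symm)
      intro T
      have hT : T ∈ H ⊔ AddSubgroup.zmultiples R := by rw [htop']; exact AddSubgroup.mem_top T
      obtain ⟨h, hh, z, hz, rfl⟩ := AddSubgroup.mem_sup.mp hT
      obtain ⟨k, rfl⟩ := AddSubgroup.mem_zmultiples_iff.mp hz
      have h1 : σ • (h + k • R) - (h + k • R) = σ • h - h := by
        rw [smul_add, hσz, hσR]; abel
      rw [h1]
      exact H.sub_mem (hH σ h hh) hh
  -- hence `Stab(P₀) = Γ_ℚ` or `{σ : (σ − 1) E[p] ⊆ H} = Γ_ℚ`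
  have hcases : (∀ σ : absoluteGaloisGroup ℚ, σ • P₀ = P₀) ∨
      ∀ (σ : absoluteGaloisGroup ℚ) (T : W.geomTorsion p), σ • T - T ∈ H := by
    refine forall_or_forall_of_forall_or hdich (fun σ₁ σ₂ h12 h2 ↦ ?_) (fun σ₁ σ₂ h12 h1 T ↦ ?_)
    · rw [mul_smul, h2] at h12
      exact h12
    · have h3 : (σ₁ * σ₂) • T - T - (σ₁ • (σ₂ • T) - σ₂ • T) = σ₂ • T - T := by
        rw [mul_smul]; abel
      rw [← h3]
      exact H.sub_mem (h12 T) (h1 (σ₂ • T))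
  rcases hcases with hA | hB
  · -- `P₀` is `Γ_ℚ`-fixed: a rational point of order `p` on `W` itself
    obtain ⟨Q, hQ, -⟩ := exists_addOrderOf_eq_of_smul_eq W hP₀0 hA
    exact Or.inl ⟨Q, hQ⟩
  · exact Or.inr ⟨H, hHcard, hH, hB⟩

/-! ### §2. From the Shimura index -/

variable [W.IsGloballyMinimal] {N : ℕ} [NeZero N]

/-- **The Shimura-index dichotomy.**  If `Λ₀(f)/Λ₁(f)` has an element of order `p` for the newform `f` of a globally minimal
elliptic `W/ℚ`, then either `W(ℚ)` has a point of order `p`, or `W[p]` has a `Γ_ℚ`-stable line `H` of order `p` with `Γ_ℚ` acting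
trivially on `W[p]/H` (the `μ_p`-configuration).  (`a_ℓ ≡ ℓ + 1 (mod p)` at every good prime by
`dvd_frobeniusTrace_sub_of_not_shimuraIndexPrimeTo`; Frobenius fixed vectors by `forall_exists_smul_eq_of_frobeniusTrace_congr`; §1.)
[cite: Katz1980, Thm. 2 (m = ℓ)] [cite: Ribet1988Shimura, Thm. 1 and §3] -/
theorem exists_addOrderOf_eq_or_exists_trivialQuotientLine_of_not_shimuraIndexPrimeTo
    {f : CuspForm (Gamma0 N) 2} (hf : IsNewformOf W f) {p : ℕ} (hp : p.Prime) (hS : ¬ ShimuraIndexPrimeTo p f) :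
    (∃ Q : W.toAffine.Point, addOrderOf Q = p) ∨
      ∃ H : AddSubgroup (W.geomTorsion p), Nat.card H = p ∧
        (∀ σ : absoluteGaloisGroup ℚ, ∀ a ∈ H, σ • a ∈ H) ∧
        ∀ (σ : absoluteGaloisGroup ℚ) (T : W.geomTorsion p), σ • T - T ∈ H := by
  haveI : Fact p.Prime := ⟨hp⟩
  exact exists_addOrderOf_eq_or_exists_trivialQuotientLine_of_forall_exists_smul_eq W p
    (forall_exists_smul_eq_of_frobeniusTrace_congr W p
      fun ℓ _ _ hgood ↦ dvd_frobeniusTrace_sub_of_not_shimuraIndexPrimeTo W hf hp hS hgood)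

/-- Contrapositive: **no rational point of order `p` on `W` and no `μ_p`-configuration in `W[p]` ⟹ `p ∤ [Λ₀(f) : Λ₁(f)]`.**
[cite: Katz1980, Thm. 2 (m = ℓ)] [cite: Ribet1988Shimura, Thm. 1 and §3] -/
theorem shimuraIndexPrimeTo_of_no_torsion_of_no_trivialQuotientLine
    {f : CuspForm (Gamma0 N) 2} (hf : IsNewformOf W f) {p : ℕ} (hp : p.Prime)
    (hT : ∀ Q : W.toAffine.Point, addOrderOf Q ≠ p)
    (hμ : ∀ H : AddSubgroup (W.geomTorsion p), Nat.card H = p →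
      (∀ σ : absoluteGaloisGroup ℚ, ∀ a ∈ H, σ • a ∈ H) →
      ∃ (σ : absoluteGaloisGroup ℚ) (T : W.geomTorsion p), σ • T - T ∉ H) :
    ShimuraIndexPrimeTo p f := by
  by_contra hS
  rcases exists_addOrderOf_eq_or_exists_trivialQuotientLine_of_not_shimuraIndexPrimeTo W hf hp hS with
    ⟨Q, hQ⟩ | ⟨H, hH, hst, htriv⟩
  · exact hT Q hQ
  · obtain ⟨σ, T, hσT⟩ := hμ H hH hst
    exact hσT (htriv σ T)

/-- The plus-index form of the contrapositive. [cite: Katz1980, Thm. 2 (m = ℓ)] [cite: LingOesterle1991, §1] -/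
theorem plusIndexPrimeTo_of_no_torsion_of_no_trivialQuotientLine
    {f : CuspForm (Gamma0 N) 2} (hf : IsNewformOf W f) {p : ℕ} (hp : p.Prime)
    (hT : ∀ Q : W.toAffine.Point, addOrderOf Q ≠ p)
    (hμ : ∀ H : AddSubgroup (W.geomTorsion p), Nat.card H = p →
      (∀ σ : absoluteGaloisGroup ℚ, ∀ a ∈ H, σ • a ∈ H) →
      ∃ (σ : absoluteGaloisGroup ℚ) (T : W.geomTorsion p), σ • T - T ∉ H) :
    PlusIndexPrimeTo p f :=
  plusIndexPrimeTo_of_shimuraIndexPrimeTo hp f (shimuraIndexPrimeTo_of_no_torsion_of_no_trivialQuotientLine W hf hp hT hμ)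

/-! ### §3. `p = 3`: E-es-67's open part pinned to the `μ₃`-configuration (every level, no optimality) -/

/-- **At `p = 3`:** `3 ∣ [Λ₀(f) : Λ₁(f)]` ⟹ a rational point of order `3` on `W`, or a `Γ_ℚ`-stable `3`-line of `W` with trivial
quotient character (the `μ₃`-configuration: `W = W′/⟨Q⟩` for a rational `3`-point `Q` of a `3`-isogenous `W′`).
[cite: Katz1980, Thm. 2 (m = ℓ)] [cite: Ribet1988Shimura, Thm. 1 and §3] -/
theorem exists_addOrderOf_eq_three_or_trivialQuotientLine_of_not_shimuraIndexPrimeTo_three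
    {f : CuspForm (Gamma0 N) 2} (hf : IsNewformOf W f) (hS : ¬ ShimuraIndexPrimeTo 3 f) :
    (∃ Q : W.toAffine.Point, addOrderOf Q = 3) ∨
      ∃ H : AddSubgroup (W.geomTorsion 3), Nat.card H = 3 ∧
        (∀ σ : absoluteGaloisGroup ℚ, ∀ a ∈ H, σ • a ∈ H) ∧
        ∀ (σ : absoluteGaloisGroup ℚ) (T : W.geomTorsion 3), σ • T - T ∈ H :=
  exists_addOrderOf_eq_or_exists_trivialQuotientLine_of_not_shimuraIndexPrimeTo W hf Nat.prime_three hS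

/-- **E-es-67 off the `μ₃`-configuration (PROVED, every level):** no rational point of order `3` on `W` and no `Γ_ℚ`-stable `3`-line
with trivial quotient character ⟹ `PlusIndexPrimeTo 3 f`. [cite: Katz1980, Thm. 2 (m = ℓ)] [cite: LingOesterle1991, §1] -/
theorem plusIndexPrimeTo_three_of_no_threeTorsion_of_no_trivialQuotientLine
    {f : CuspForm (Gamma0 N) 2} (hf : IsNewformOf W f)
    (hT : ∀ Q : W.toAffine.Point, addOrderOf Q ≠ 3)
    (hμ : ∀ H : AddSubgroup (W.geomTorsion 3), Nat.card H = 3 →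
      (∀ σ : absoluteGaloisGroup ℚ, ∀ a ∈ H, σ • a ∈ H) →
      ∃ (σ : absoluteGaloisGroup ℚ) (T : W.geomTorsion 3), σ • T - T ∉ H) :
    PlusIndexPrimeTo 3 f :=
  plusIndexPrimeTo_of_no_torsion_of_no_trivialQuotientLine W hf Nat.prime_three hT hμ

end Summit.BirchSwinnertonDyer.BirchSwinnertonDyer.Theorems.ManinLocalTwoThree

end
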